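import Summits.KontsevichZagierPeriods.Zeta5Search.WedgeDictionaryCornerTransfer
import HarnessLib

/-!
# The wedge dictionary on the corner: `cornerIdentity` and `cornerW_level7` PROVED (cell `pub-zeta5`, P1)

HONEST FRAMING: systematic search; no irrationality claim unless certified.

OUR work (Summit side), P1 seat generation 2. From the recurrence and the contiguity relation of
`WedgeDictionaryCornerTransfer.lean` (creative telescoping in `t`, transferred to the canonical coefficients
by uniqueness of partial fractions):

* `corner_casoratian` — `U_n W_{n+1} − U_{n+1} W_n = −56·(−1)^n (3n+1)!/(n!⁶ (n+1)!⁹)` (Casoratian of the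
  order-two recurrence; initial values `U₀ = 2, W₀ = 0, U₁ = −8, W₁ = −28` of `WedgeDictionaryCorner.lean`);
* `quadM3_bCorner` — `M₃(n;0⁷) = (−1)^n · 4 · (3n)!/(n!)¹⁵` for EVERY `n`;
* `cornerIdentity_holds : cornerIdentity` — the corner sub-conjecture of the cell's `wedgeDictionary`
  (gen-1 g3, `@[conjecture] cornerIdentity`; previously: instances `n = 1, 2`) is a THEOREM: the first infinite
  family of cases of the `Q`-part of the dictionary (`cornerIdentity_of_wedgeDictionary` is its converse direction);
* `cornerW_level7_holds : cornerW_level7` — the corner `ζ(3)`-coefficients, gauged by `(−1)^n n!⁶`, solve the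
  level-7 Apéry-like recurrence `(n+1)³y_{n+1} = (2n+1)(13n²+13n+4)y_n + 3n(9n²−1)y_{n−1}`;
* `cornerU_recurrence` — the same recurrence for the gauged `ζ(5)`-coefficients `(−1)^n n!⁶ U_n` (the remaining
  content of `cornerU_level7` is the identification with Cooper's binomial sums `s₇`, i.e. that `s₇` solves this
  recurrence; not done here).
-/

noncomputable section

open Finset

namespace Summit.KontsevichZagierPeriods.Zeta5Search.WedgeDictionary

/-! ### The Casoratian of the order-two recurrence -/

/-- The Casoratian `C_n = U_n W_{n+1} − U_{n+1} W_n` of the corner coefficients. -/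
def cornerCas (n : ℕ) : ℚ :=
  coeffU (bCorner n) * coeffW (bCorner (n + 1)) - coeffU (bCorner (n + 1)) * coeffW (bCorner n)

/-- `C₀ = 2·(−28) − (−8)·0 = −56`. -/
theorem cornerCas_zero : cornerCas 0 = -56 := by
  rw [cornerCas, coeff_bCorner_zero.1, coeff_bCorner_zero.2, coeff_bCorner_one.1, coeff_bCorner_one.2]; norm_num

/-- Abel's relation: `p₂(n) C_{n+1} = p₀(n) C_n`. -/
theorem cornerCas_succ (n : ℕ) : recP2 n * cornerCas (n + 1) = recP0 n * cornerCas n := by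
  obtain ⟨hU, hW⟩ := corner_recurrence n
  unfold cornerCas
  rw [show n + 1 + 1 = n + 2 from rfl]
  linear_combination coeffU (bCorner (n + 1)) * hW - coeffW (bCorner (n + 1)) * hU

/-- **Closed form of the Casoratian**: `C_n = −56·(−1)^n·(3n+1)!/(n!⁶ (n+1)!⁹)`. -/
theorem corner_casoratian (n : ℕ) :
    cornerCas n = -56 * (-1) ^ n * ((3 * n + 1).factorial : ℚ) /
      ((n.factorial : ℚ) ^ 6 * ((n + 1).factorial : ℚ) ^ 9) := by
  induction n with
  | zero => rw [cornerCas_zero]; simp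
  | succ m ih =>
    have key := cornerCas_succ m
    rw [ih] at key
    have hp2 : recP2 (m : ℚ) ≠ 0 := by unfold recP2; positivity
    have hf : (m.factorial : ℚ) ≠ 0 := by positivity
    have hf1 : ((m + 1).factorial : ℚ) ≠ 0 := by positivity
    have f1 : ((3 * (m + 1) + 1).factorial : ℚ)
        = (3 * (m : ℚ) + 2) * (3 * (m : ℚ) + 3) * (3 * (m : ℚ) + 4) * ((3 * m + 1).factorial : ℚ) := by
      rw [show 3 * (m + 1) + 1 = (3 * m + 1) + 1 + 1 + 1 by ring]
      simp only [Nat.factorial_succ]; push_cast; ring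
    have f2 : ((m + 1 + 1).factorial : ℚ) = ((m : ℚ) + 2) * ((m + 1).factorial : ℚ) := by
      simp only [Nat.factorial_succ]; push_cast; ring
    have f3 : ((m + 1).factorial : ℚ) = ((m : ℚ) + 1) * (m.factorial : ℚ) := by
      simp only [Nat.factorial_succ]; push_cast; ring
    have hc : cornerCas (m + 1) = recP0 m * (-56 * (-1) ^ m * ((3 * m + 1).factorial : ℚ) /
        ((m.factorial : ℚ) ^ 6 * ((m + 1).factorial : ℚ) ^ 9)) / recP2 m := by
      rw [eq_div_iff hp2, mul_comm]; exact key
    rw [hc, f1, f2]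
    rw [f3]
    unfold recP0 recP2
    field_simp
    ring

/-! ### The corner identity -/

/-- The partner of `WedgeDictionaryCornerTransfer` is the literal `b + e₁` of the conjecture. -/
theorem bCorner'_eq (n : ℕ) : bCorner' n = Function.update (bCorner n) 1 (bCorner n 1 + 1) := rfl

/-- `28(3n+1)·M₃(n;0⁷) = −2(n+1)⁹·C_n` (contiguity, both coordinates). -/
theorem quadM3_bCorner_mul (n : ℕ) :
    28 * (3 * (n : ℚ) + 1) * quadM3 (bCorner n) = -2 * ((n : ℚ) + 1) ^ 9 * cornerCas n := by
  obtain ⟨hU, hW⟩ := corner_contiguity n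
  rw [← cornerMinor_eq_quadM3, ← bCorner'_eq, cornerCas]
  linear_combination coeffU (bCorner n) * hW - coeffW (bCorner n) * hU

/-- **`M₃(n;0⁷) = (−1)^n·4·(3n)!/(n!)¹⁵` for every `n`.** -/
theorem quadM3_bCorner (n : ℕ) :
    quadM3 (bCorner n) = (-1) ^ n * 4 * ((3 * n).factorial : ℚ) / ((n.factorial : ℚ)) ^ 15 := by
  have h := quadM3_bCorner_mul n
  rw [corner_casoratian] at h
  have h28 : 28 * (3 * (n : ℚ) + 1) ≠ 0 := by positivity
  have hf : (n.factorial : ℚ) ≠ 0 := by positivity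
  have hf1 : ((n + 1).factorial : ℚ) ≠ 0 := by positivity
  have h3 : (3 * (n : ℚ) + 1) ≠ 0 := by positivity
  have f1 : ((3 * n + 1).factorial : ℚ) = (3 * (n : ℚ) + 1) * ((3 * n).factorial : ℚ) := by
    simp only [Nat.factorial_succ]; push_cast; ring
  have f3 : ((n + 1).factorial : ℚ) = ((n : ℚ) + 1) * (n.factorial : ℚ) := by
    simp only [Nat.factorial_succ]; push_cast; ring
  rw [f1, f3] at h
  have hq : quadM3 (bCorner n) = -2 * ((n : ℚ) + 1) ^ 9 * (-56 * (-1) ^ n * ((3 * (n : ℚ) + 1)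
      * ((3 * n).factorial : ℚ)) / ((n.factorial : ℚ) ^ 6 * (((n : ℚ) + 1) * (n.factorial : ℚ)) ^ 9))
      / (28 * (3 * (n : ℚ) + 1)) := by
    rw [eq_div_iff h28, mul_comm]; exact h
  rw [hq]
  field_simp
  ring

/-- **THE CORNER IDENTITY IS A THEOREM** (the conjecture `cornerIdentity` of `WedgeDictionaryCorner.lean`, all `n ≥ 1`;
in fact `quadM3_bCorner` holds for every `n`). -/
theorem cornerIdentity_holds : cornerIdentity := fun n _ => quadM3_bCorner n

/-- The literal first conjunct of `wedgeDictionary` at every corner point `a = (n,0,n,0,n,n,n,n)`, partner `j = 1`: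
`Q(a) = ρ(a)·(U(b)W(b') − U(b')W(b))` (stated there for `n ≥ 1`; it holds for every `n`). -/
theorem Q_identity_corner (n : ℕ) :
    (Literature.NumberTheory.Irrationality.BrownZudilin2022.QOf (aCorner n) : ℚ) =
      rhoOf (aCorner n) * (coeffU (bCorner n) * coeffW (Function.update (bCorner n) 1 (bCorner n 1 + 1)) -
        coeffU (Function.update (bCorner n) 1 (bCorner n 1 + 1)) * coeffW (bCorner n)) := by
  rw [cornerMinor_eq_quadM3, quadM3_bCorner, QOf_aCorner, rhoOf_aCorner]
  have hf : (n.factorial : ℚ) ≠ 0 := by positivity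
  have hf3 : ((3 * n).factorial : ℚ) ≠ 0 := by positivity
  push_cast
  field_simp

/-! ### The level-7 recurrence of the gauged coefficients -/

/-- **`cornerW_level7` IS A THEOREM**: `w̃_m = (−1)^m m!⁶ W(m;0⁷)` solves
`(n+1)³ w̃_{n+1} = (2n+1)(13n²+13n+4) w̃_n + 3n(9n²−1) w̃_{n−1}` for `n ≥ 1`. -/
theorem cornerW_level7_holds : cornerW_level7 := by
  intro n hn
  obtain ⟨m, rfl⟩ : ∃ m, n = m + 1 := ⟨n - 1, by omega⟩
  have hW := (corner_recurrence m).2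
  simp only [show m + 1 - 1 = m from rfl, show m + 1 + 1 = m + 2 from rfl]
  have f2 : ((m + 2).factorial : ℚ) = ((m : ℚ) + 2) * ((m : ℚ) + 1) * (m.factorial : ℚ) := by
    rw [show m + 2 = m + 1 + 1 from rfl]; simp only [Nat.factorial_succ]; push_cast; ring
  have f3 : ((m + 1).factorial : ℚ) = ((m : ℚ) + 1) * (m.factorial : ℚ) := by
    simp only [Nat.factorial_succ]; push_cast; ring
  rw [f2, f3]
  unfold recP0 recP1 recP2 at hW
  push_cast
  linear_combination ((-1 : ℚ) ^ m * (m.factorial : ℚ) ^ 6 * ((m : ℚ) + 1)) * hW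

/-- The same recurrence for the gauged `ζ(5)`-coefficients `ũ_m = (−1)^m m!⁶ U(m;0⁷)` (all `n ≥ 1`). -/
theorem cornerU_recurrence (n : ℕ) (hn : 1 ≤ n) :
    ((n : ℚ) + 1) ^ 3 * ((-1) ^ (n + 1) * ((n + 1).factorial : ℚ) ^ 6 * coeffU (bCorner (n + 1))) =
      (2 * n + 1) * (13 * (n : ℚ) ^ 2 + 13 * n + 4) * ((-1) ^ n * (n.factorial : ℚ) ^ 6 * coeffU (bCorner n)) +
        3 * n * (9 * (n : ℚ) ^ 2 - 1) * ((-1) ^ (n - 1) * ((n - 1).factorial : ℚ) ^ 6 * coeffU (bCorner (n - 1))) := by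
  obtain ⟨m, rfl⟩ : ∃ m, n = m + 1 := ⟨n - 1, by omega⟩
  have hU := (corner_recurrence m).1
  simp only [show m + 1 - 1 = m from rfl, show m + 1 + 1 = m + 2 from rfl]
  have f2 : ((m + 2).factorial : ℚ) = ((m : ℚ) + 2) * ((m : ℚ) + 1) * (m.factorial : ℚ) := by
    rw [show m + 2 = m + 1 + 1 from rfl]; simp only [Nat.factorial_succ]; push_cast; ring
  have f3 : ((m + 1).factorial : ℚ) = ((m : ℚ) + 1) * (m.factorial : ℚ) := by
    simp only [Nat.factorial_succ]; push_cast; ring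
  rw [f2, f3]
  unfold recP0 recP1 recP2 at hU
  push_cast
  linear_combination ((-1 : ℚ) ^ m * (m.factorial : ℚ) ^ 6 * ((m : ℚ) + 1)) * hU

end Summit.KontsevichZagierPeriods.Zeta5Search.WedgeDictionary
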